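import Mathlib.Combinatorics.SimpleGraph.Connectivity.Finite
import Mathlib.Combinatorics.SimpleGraph.Maps
import Mathlib.Data.Fintype.Card
import Mathlib.Data.Fintype.Sum
import Mathlib.Logic.Equiv.Fin.Rotate
import Literature.Topology.FourManifolds.LinkGaussDiagrams
import Literature.Topology.FourManifolds.KhResolutions
import HarnessLib

/-!
# Complete resolutions of a link Gauss diagram (link tower, layer D2a: the cube of resolutions)

Second file of the link tower begun in `LinkGaussDiagrams` (layer D1: `LinkGaussDiagram`,
`ofGaussDiagram`, `Arc`, `arcOut`, `arcIn`, `unknots`, `birth`, `death`, `saddle`; census of crux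
`ZseThesis`, stmt-SmoothPoincare4-0364, debt (D2)): the *complete resolutions* (Kauffman states) of
a Gauss diagram of an oriented LINK as abstract circle surgery, mirroring declaration by declaration
the knot tower's `KhResolutions` (`GaussDiagram.chordOf`, `partner`, `nPlus`, `nMinus`,
`writhe_eq_sub`, `State`, `State.weight`, `isSeifert`, `stateAdj`, `stateGraph`, `StateCircle`,
`circleCount`, `circleOf`, `IsMergeAt`, `IsSplitAt`, the decidability instances, the proved fact
`IsMergeAt.not_isSplitAt`), so that the next layers (enhanced states, `khovanovD`, Lee cycles) can
be ported by the same rule.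

## The design rule: `p + 1 ↦ next p`

The knot tower lives on ONE based circle and uses the cyclic order of the `2n` marked points only
through the arcs (arc `q` runs from `q` to `q + 1`; `arcOut p = p`, `arcIn p = p - 1 (mod 2n)`).
A link Gauss diagram (GPV (2000), §1: one circle per component) replaces the cyclic order by the
traversal successor `next : Equiv.Perm (Fin (2 * n))` and adds `free` chord-free circles;
`LinkGaussDiagrams` sets `Arc = Fin (2n) ⊕ Fin free`, `arcOut p = inl p`,
`arcIn p = arcOut (next⁻¹ p)`. EVERY definition below is the knot tower's with this substitution and
nothing else: `chordOf`, `partner`, `nPlus`, `nMinus`, `State`, `State.weight`, `isSeifert` read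
only `overPos/underPos/sign` and are copied verbatim (on `ofGaussDiagram G` they are those of `G`
definitionally, all `rfl`); the
reconnection relation `stateAdj σ` has the knot tower's four clauses with the link `arcIn`/`arcOut`
(Seifert chord `{p, p'}`: `arcIn p ~ arcOut p'` and symmetrically; otherwise `arcIn p ~ arcIn p'`,
`arcOut p ~ arcOut p'`; Viro (2004), §2, §5), so a free circle `inr j` is related to nothing and is
a state circle on its own in every state (`circleOf_inr_eq_iff`; Khovanov (2000), §4.2: a
crossingless component is one circle of every resolution); `stateGraph`, `StateCircle`,
`circleCount`, `circleOf`, `IsMergeAt`, `IsSplitAt` (local strands `arcIn (overPos i)`,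
`arcOut (overPos i)`) verbatim.

## Agreement with the knot tower, and the `n = 0` caveat

For `G.n ≠ 0` the arcs of `ofGaussDiagram G` and of `G` correspond under the explicit equivalence
`arcEquiv G : (ofGaussDiagram G).Arc ≃ G.Arc`, `inl p ↦ p` (`GaussDiagram.Arc = Fin G.arcCount`,
`arcCount = max (2n) 1 = 2n` here); it carries `arcOut` to `GaussDiagram.arcOut` (`rfl`), `arcIn` to
`GaussDiagram.arcIn` (`arcEquiv_arcIn`, i.e. `(finRotate (2n))⁻¹ p = (p + 2n - 1) % 2n`,
`val_finRotate_symm`), `stateAdj` to `stateAdj` (`stateAdj_ofGaussDiagram_iff`), hence the state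
graph isomorphically onto the state graph (`stateGraphIso`), state circles to state circles
(`circleOf_ofGaussDiagram_eq_iff`), `circleCount` to `circleCount` (`circleCount_ofGaussDiagram`)
and merges / splits to merges / splits (`isMergeAt_ofGaussDiagram_iff`,
`isSplitAt_ofGaussDiagram_iff`).

CAVEAT (`n = 0`). The knot tower gives the EMPTY diagram one arc (`arcCount = max (2n) 1`, the whole
round circle) and one state circle (`GaussDiagram.circleCount_empty`), whereas
`ofGaussDiagram GaussDiagram.empty = unknots 0` (`ofGaussDiagram_empty`) has no arc and no state
circle (`circleCount_ofGaussDiagram_of_n_eq_zero`). In the link tower the crossingless unknot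
diagram is `unknots 1 = (unknots 0).birth` (ONE FREE circle: `circleCount_unknots`,
`birth_unknots`), not the image of `GaussDiagram.empty`; so the correspondence theorems carry the
hypothesis `G.n ≠ 0`, and the next layers must identify the (one-circle) Khovanov / Lee data of
`GaussDiagram.empty` and of `unknots 1` by hand.

## Also in this file

* counting: `stateCircleEquiv σ : L.StateCircle σ ≃ (L.coreGraph σ).ConnectedComponent ⊕ Fin L.free`
  (circles through marked points ⊔ free circles; `coreGraph σ`, the reconnection graph read on
  marked points, does not see `free`), `circleCount_eq_card_add_free`; hence `circleCount_unknots`,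
  `circleCount_birth` (`+ 1`), `circleCount_death` (`- 1` when `free ≠ 0`; a death with `free = 0`
  is the identity) and `arc_saddle : (L.saddle p q).Arc = L.Arc` (`rfl`; merge-versus-split of a
  saddle is the next layer);
* `IsMergeAt.not_isSplitAt` for every (possibly virtual) link diagram: the knot tower's parity count
  on arc-ends verbatim, the involution `endFlip` being built from `next` / `next⁻¹` instead of
  `p ± 1`;
* sanity (`decide`): the positive Hopf link `hopfLink` (two components, `next = (0 1)(2 3)`) has
  `2, 1, 2` circles in the states `00, 10, 11` and its flip at chord `0` from `00` is a merge; the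
  kink of `KhResolutions` transported through `ofGaussDiagram` by the correspondence.

Not here (next layers): enhanced states and the Khovanov / Frobenius / Lee complexes of a link
diagram (port of `KhComplex`, `LeeRasmussen` by the same rule); realisability by a regular
projection of a `Link ι` and the merge-or-split dichotomy for realisable link diagrams (the
analogue of the named fact `GaussDiagram.isMergeAt_or_isSplitAt_of_hasGaussDiagram` needs a
realisability predicate for links, which does not exist yet — the only declaration of
`KhResolutions` without a counterpart here, besides the sanity data `kink`, `trefoilDiagram`,
reused through `ofGaussDiagram`); the effect of `saddle` on state circles; Reidemeister moves of
link diagrams.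

## References

* M. Khovanov, *A categorification of the Jones polynomial*, Duke Math. J. 101 (2000) 359–426,
  §4.2 (complete resolutions; crossingless components). [cite: Khovanov2000, §4.2]
* D. Bar-Natan, *On Khovanov's categorification of the Jones polynomial*, Algebr. Geom. Topol. 2
  (2002) 337–370, §3.1 (cube of smoothings, `n₊`, `n₋`, number of cycles).
  [cite: BarNatan2002, §3.1]
* O. Viro, *Khovanov homology, its definitions and ramifications*, Fund. Math. 184 (2004)
  317–342, §2 (Kauffman states), §5 (Gauss diagrams, virtual case; §5.2). [cite: Viro2004, §2]
* M. Goussarov, M. Polyak, O. Viro, *Finite-type invariants of classical and virtual knots*,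
  Topology 39 (2000) 1045–1068, §1 (Gauss diagrams of knots and links). [cite: GPV2000, §1]
* J. Rasmussen, *Khovanov homology and the slice genus*, Invent. Math. 182 (2010), §4.1
  (elementary cobordisms). [cite: Rasmussen2010, §4.1]
* Mathlib: `SimpleGraph.fromRel`, `SimpleGraph.ConnectedComponent` (`.lift`, `.map`, `.sound`,
  `Fintype` instance of `Connectivity.Finite`), `SimpleGraph.Iso.connectedComponentEquiv`,
  `SimpleGraph.Iso.reachable_iff`, `finRotate`, `coe_finRotate`, `Fin.find`.
-/

open Function Set

noncomputable section

namespace Literature.Topology.FourManifolds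

namespace LinkGaussDiagram

variable (L : LinkGaussDiagram)

/-! ## The knot tower inside the link tower: the fields of `ofGaussDiagram` -/

/-- The image of a knot diagram has no free circle. [folklore] -/
@[simp] theorem ofGaussDiagram_free (G : GaussDiagram) : (ofGaussDiagram G).free = 0 := rfl

/-- The image of a knot diagram has the same over-passages. [folklore] -/
@[simp] theorem ofGaussDiagram_overPos (G : GaussDiagram) :
    (ofGaussDiagram G).overPos = G.overPos := rfl

/-- The image of a knot diagram has the same under-passages. [folklore] -/
@[simp] theorem ofGaussDiagram_underPos (G : GaussDiagram) :
    (ofGaussDiagram G).underPos = G.underPos := rfl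

/-- The image of a knot diagram has the same signs. [folklore] -/
@[simp] theorem ofGaussDiagram_sign (G : GaussDiagram) : (ofGaussDiagram G).sign = G.sign := rfl

/-- The successor of the image of a knot diagram is `p ↦ p + 1`, `finRotate`. GPV (2000), §1.
[cite: GPV2000, §1] -/
@[simp] theorem ofGaussDiagram_next (G : GaussDiagram) :
    (ofGaussDiagram G).next = finRotate (2 * G.n) := rfl

/-! ## Chord bookkeeping (verbatim from the knot tower) -/

/-- Every marked point of a link Gauss diagram is an end (over- or under-passage) of some chord
(surjectivity half of `LinkGaussDiagram.bijective`). GPV (2000), §1. [cite: GPV2000, §1] -/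
theorem exists_chord (p : Fin (2 * L.n)) : ∃ i, L.overPos i = p ∨ L.underPos i = p := by
  obtain ⟨i | i, hi⟩ := L.bijective.surjective p
  · exact ⟨i, Or.inl hi⟩
  · exact ⟨i, Or.inr hi⟩

/-- `overPos` is injective (from `LinkGaussDiagram.bijective`). [folklore] -/
theorem overPos_injective : Injective L.overPos := fun i j h ↦
  Sum.inl_injective (L.bijective.injective (a₁ := .inl i) (a₂ := .inl j) h)

/-- `underPos` is injective (from `LinkGaussDiagram.bijective`). [folklore] -/
theorem underPos_injective : Injective L.underPos := fun i j h ↦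
  Sum.inr_injective (L.bijective.injective (a₁ := .inr i) (a₂ := .inr j) h)

/-- An over-passage is never an under-passage (from `LinkGaussDiagram.bijective`). [folklore] -/
theorem overPos_ne_underPos (i j : Fin L.n) : L.overPos i ≠ L.underPos j := fun h ↦
  Sum.inl_ne_inr (L.bijective.injective (a₁ := .inl i) (a₂ := .inr j) h)

/-- The **chord through the marked point** `p`: the unique chord `i` with `overPos i = p` or
`underPos i = p`, by `Fin.find` (computable, reduces under `decide`), verbatim as
`GaussDiagram.chordOf`. GPV (2000), §1. [cite: GPV2000, §1] -/
def chordOf (p : Fin (2 * L.n)) : Fin L.n :=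
  Fin.find (fun i ↦ L.overPos i = p ∨ L.underPos i = p) (L.exists_chord p)

/-- The defining property of `chordOf p`: `p` is one of its two ends. [folklore] -/
theorem chordOf_spec (p : Fin (2 * L.n)) :
    L.overPos (L.chordOf p) = p ∨ L.underPos (L.chordOf p) = p :=
  Fin.find_spec (L.exists_chord p)

/-- The chord through the over-passage of chord `i` is `i`. [folklore] -/
@[simp]
theorem chordOf_overPos (i : Fin L.n) : L.chordOf (L.overPos i) = i := by
  rcases L.chordOf_spec (L.overPos i) with h | h
  · exact L.overPos_injective h
  · exact ((L.overPos_ne_underPos _ _) h.symm).elim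

/-- The chord through the under-passage of chord `i` is `i`. [folklore] -/
@[simp]
theorem chordOf_underPos (i : Fin L.n) : L.chordOf (L.underPos i) = i := by
  rcases L.chordOf_spec (L.underPos i) with h | h
  · exact ((L.overPos_ne_underPos _ _) h).elim
  · exact L.underPos_injective h

/-- The chord through a point other than the two ends of chord `i` is not `i`. [folklore] -/
theorem chordOf_ne {p : Fin (2 * L.n)} {i : Fin L.n} (ho : p ≠ L.overPos i)
    (hu : p ≠ L.underPos i) : L.chordOf p ≠ i := by
  rintro rfl
  rcases L.chordOf_spec p with h | h
  · exact ho h.symm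
  · exact hu h.symm

/-- The **partner** of the marked point `p`: the other end of the chord through `p`, verbatim as
`GaussDiagram.partner`. GPV (2000), §1. [cite: GPV2000, §1] -/
def partner (p : Fin (2 * L.n)) : Fin (2 * L.n) :=
  if L.overPos (L.chordOf p) = p then L.underPos (L.chordOf p) else L.overPos (L.chordOf p)

/-- The partner of an over-passage is the under-passage of the same chord. [folklore] -/
@[simp]
theorem partner_overPos (i : Fin L.n) : L.partner (L.overPos i) = L.underPos i := by
  simp [partner]

/-- The partner of an under-passage is the over-passage of the same chord. [folklore] -/
@[simp]
theorem partner_underPos (i : Fin L.n) : L.partner (L.underPos i) = L.overPos i := by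
  simp [partner, (L.overPos_ne_underPos i i)]

/-- `partner` is an involution. [folklore] -/
@[simp]
theorem partner_partner (p : Fin (2 * L.n)) : L.partner (L.partner p) = p := by
  obtain ⟨i, rfl | rfl⟩ := L.exists_chord p <;> simp

/-- The chord through the partner of `p` is the chord through `p`. [folklore] -/
@[simp]
theorem chordOf_partner (p : Fin (2 * L.n)) : L.chordOf (L.partner p) = L.chordOf p := by
  obtain ⟨i, rfl | rfl⟩ := L.exists_chord p <;> simp

/-- A marked point is never its own partner. [folklore] -/
theorem partner_ne (p : Fin (2 * L.n)) : L.partner p ≠ p := by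
  obtain ⟨i, rfl | rfl⟩ := L.exists_chord p
  · simpa using (L.overPos_ne_underPos i i).symm
  · simpa using L.overPos_ne_underPos i i

/-- On the image of a knot diagram, `chordOf` is the knot tower's `GaussDiagram.chordOf`
(definitionally). [folklore] -/
@[simp]
theorem chordOf_ofGaussDiagram (G : GaussDiagram) (p : Fin (2 * G.n)) :
    (ofGaussDiagram G).chordOf p = G.chordOf p := rfl

/-- On the image of a knot diagram, `partner` is the knot tower's `GaussDiagram.partner`
(definitionally). [folklore] -/
@[simp]
theorem partner_ofGaussDiagram (G : GaussDiagram) (p : Fin (2 * G.n)) :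
    (ofGaussDiagram G).partner p = G.partner p := rfl

/-- The number `n₊` of **positive crossings** (chords of sign `+1`). Bar-Natan (2002), §3.1.
[cite: BarNatan2002, §3.1] -/
def nPlus : ℕ := (Finset.univ.filter fun i ↦ L.sign i = 1).card

/-- The number `n₋` of **negative crossings** (chords of sign `-1`). Bar-Natan (2002), §3.1.
[cite: BarNatan2002, §3.1] -/
def nMinus : ℕ := (Finset.univ.filter fun i ↦ L.sign i = -1).card

/-- The **writhe** of a link Gauss diagram: the sum of the signs of its chords (as
`GaussDiagram.writhe`). Bar-Natan (2002), §3.1; GPV (2000), §1. [cite: BarNatan2002, §3.1] -/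
def writhe : ℤ := ∑ i, (L.sign i : ℤ)

/-- The writhe is `n₊ - n₋`. Bar-Natan (2002), §3.1. [cite: BarNatan2002, §3.1] -/
theorem writhe_eq_sub : L.writhe = (L.nPlus : ℤ) - L.nMinus := by
  have h : ∀ i, (L.sign i : ℤ) = if L.sign i = 1 then (1 : ℤ) else -1 := fun i ↦ by
    rcases Int.units_eq_one_or (L.sign i) with h | h <;> rw [h] <;> decide
  have hf : (Finset.univ.filter fun i ↦ ¬ L.sign i = 1) =
      Finset.univ.filter fun i ↦ L.sign i = -1 :=
    Finset.filter_congr fun i _ ↦ by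
      rcases Int.units_eq_one_or (L.sign i) with h | h <;> rw [h] <;> decide
  simp only [writhe, h, Finset.sum_ite, Finset.sum_const, hf, nPlus, nMinus]
  ring

/-- On the image of a knot diagram, `n₊` is the knot tower's (definitionally). [folklore] -/
@[simp] theorem nPlus_ofGaussDiagram (G : GaussDiagram) : (ofGaussDiagram G).nPlus = G.nPlus := rfl

/-- On the image of a knot diagram, `n₋` is the knot tower's (definitionally). [folklore] -/
@[simp] theorem nMinus_ofGaussDiagram (G : GaussDiagram) : (ofGaussDiagram G).nMinus = G.nMinus :=
  rfl

/-- On the image of a knot diagram, the writhe is the accepted `GaussDiagram.writhe`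
(definitionally). [folklore] -/
@[simp] theorem writhe_ofGaussDiagram (G : GaussDiagram) : (ofGaussDiagram G).writhe = G.writhe :=
  rfl

/-! ## States and the Seifert rule (verbatim from the knot tower) -/

/-- A **state** (complete resolution, Kauffman state) of a link Gauss diagram: a smoothing at every
chord, `false` for the `0`-smoothing and `true` for the `1`-smoothing. Khovanov (2000), §4.2;
Bar-Natan (2002), §3.1; Viro (2004), §2. [cite: Khovanov2000, §4.2] -/
abbrev State : Type := Fin L.n → Bool

/-- The **weight** (height) `|σ|` of a state: the number of `1`-smoothings. Bar-Natan (2002), §3.1.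
[cite: BarNatan2002, §3.1] -/
def State.weight {L : LinkGaussDiagram} (σ : L.State) : ℕ :=
  (Finset.univ.filter fun i ↦ σ i = true).card

/-- The **Seifert rule**, verbatim as `GaussDiagram.isSeifert`: in the state `σ` the smoothing
chosen at chord `i` is Seifert's (orientation-consistent) one iff it is the `0`-smoothing at a
positive crossing or the `1`-smoothing at a negative one (grading normalisation of Bar-Natan
(2002), §3.1 and Rasmussen (2010), §2; Viro (2004), §5: untwisted band at the Seifert chords,
half-twisted band at the others). [cite: BarNatan2002, §3.1] -/
def isSeifert (σ : L.State) (i : Fin L.n) : Bool :=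
  (σ i == false) == (L.sign i == 1)

/-- The Seifert rule at a chord `j ≠ i` does not see a change of smoothing at `i`. [folklore] -/
theorem isSeifert_update_of_ne (σ : L.State) {i j : Fin L.n} (b : Bool) (h : j ≠ i) :
    L.isSeifert (Function.update σ i b) j = L.isSeifert σ j := by
  simp [isSeifert, Function.update_of_ne h]

/-- On the image of a knot diagram, the Seifert rule is the knot tower's (definitionally; the states
of `ofGaussDiagram G` are the states of `G`). [folklore] -/
@[simp]
theorem isSeifert_ofGaussDiagram (G : GaussDiagram) (σ : G.State) (i : Fin G.n) :
    (ofGaussDiagram G).isSeifert σ i = G.isSeifert σ i := rfl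

/-- On the image of a knot diagram, the weight of a state is the knot tower's (definitionally).
[folklore] -/
@[simp]
theorem weight_ofGaussDiagram (G : GaussDiagram) (σ : G.State) :
    State.weight (L := ofGaussDiagram G) σ = σ.weight := rfl

/-! ## Arcs and state circles (`p + 1 ↦ next p`) -/

/-- The arc entering `next p` is the arc leaving `p` (knot tower: `arcIn (p + 1) = arcOut p`).
[folklore] -/
@[simp]
theorem arcIn_next (p : Fin (2 * L.n)) : L.arcIn (L.next p) = L.arcOut p := by
  simp [arcIn, arcOut]

/-- The arc leaving `next⁻¹ p` is the arc entering `p` (knot tower: `arcOut (p - 1) = arcIn p`).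
[folklore] -/
@[simp]
theorem arcOut_next_symm (p : Fin (2 * L.n)) : L.arcOut (L.next.symm p) = L.arcIn p := rfl

/-- `arcOut` is injective. [folklore] -/
theorem arcOut_injective : Injective L.arcOut := fun _ _ h ↦ Sum.inl_injective h

/-- `arcIn` is injective. [folklore] -/
theorem arcIn_injective : Injective L.arcIn := fun _ _ h ↦
  L.next.symm.injective (Sum.inl_injective h)

/-- The **reconnection relation** of the state `σ` on arcs, the knot tower's `GaussDiagram.stateAdj`
with `p + 1 ↦ next p`: two distinct arcs are related if they are glued end to end by the smoothing
of some chord `{p, p'}` (`p' = partner p`) — at a Seifert chord `arcIn p ~ arcOut p'` (and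
symmetrically), at the other chords `arcIn p ~ arcIn p'` and `arcOut p ~ arcOut p'`. Free circles
are related to nothing. Loops are discarded (this does not change connectivity). Viro (2004), §2,
§5; Khovanov (2000), §4.2. [cite: Viro2004, §2] -/
def stateAdj (σ : L.State) (a b : L.Arc) : Prop :=
  a ≠ b ∧ ∃ p : Fin (2 * L.n),
    (L.isSeifert σ (L.chordOf p) = true ∧
      ((a = L.arcIn p ∧ b = L.arcOut (L.partner p)) ∨
        (b = L.arcIn p ∧ a = L.arcOut (L.partner p)))) ∨
    (L.isSeifert σ (L.chordOf p) = false ∧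
      ((a = L.arcIn p ∧ b = L.arcIn (L.partner p)) ∨
        (a = L.arcOut p ∧ b = L.arcOut (L.partner p))))

/-- The reconnection relation of a state is decidable (a finite disjunction of equalities), so that
state circles can be counted by `decide`. [folklore] -/
instance (σ : L.State) : DecidableRel (L.stateAdj σ) := fun a b ↦ by
  unfold stateAdj; infer_instance

/-- The **state graph** of the state `σ`: the simple graph on arcs generated (`SimpleGraph.fromRel`:
symmetrised, loops removed) by the reconnection relation. Its connected components are the circles
of the complete resolution `σ`. Viro (2004), §2. [cite: Viro2004, §2] -/
def stateGraph (σ : L.State) : SimpleGraph L.Arc :=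
  SimpleGraph.fromRel (L.stateAdj σ)

/-- Adjacency in the state graph is decidable. [folklore] -/
instance (σ : L.State) : DecidableRel (L.stateGraph σ).Adj := fun a b ↦ by
  unfold stateGraph; infer_instance

/-- The type of **state circles** of the state `σ`: the connected components of the resolved
1-manifold, i.e. of the state graph on arcs (a `Fintype`). Khovanov (2000), §4.2; Bar-Natan (2002),
§3.1; Viro (2004), §2. [cite: Khovanov2000, §4.2] -/
abbrev StateCircle (σ : L.State) : Type := (L.stateGraph σ).ConnectedComponent

/-- Equality of state circles is decidable (core's `Quotient.decidableEq` on the reachability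
setoid, as in the knot tower). [folklore] -/
instance (σ : L.State) : DecidableEq (L.StateCircle σ) :=
  @Quotient.decidableEq _ (L.stateGraph σ).reachableSetoid
    (fun a b ↦ inferInstanceAs (Decidable ((L.stateGraph σ).Reachable a b)))

/-- The **number of circles** of the complete resolution `σ` (free circles included).
Khovanov (2000), §4.2; Bar-Natan (2002), §3.1. [cite: Khovanov2000, §4.2] -/
def circleCount (σ : L.State) : ℕ := Fintype.card (L.StateCircle σ)

/-- The state circle containing the arc `a` in the state `σ`. [folklore] -/
def circleOf (σ : L.State) (a : L.Arc) : L.StateCircle σ :=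
  (L.stateGraph σ).connectedComponentMk a

/-! ## Merge, split, or neither (verbatim from the knot tower) -/

/-- The edge `σ → σ[i ↦ 1]` of the cube is a **merge** at chord `i`: `σ i = 0` and, before the flip,
the two local strands `arcIn (overPos i)`, `arcOut (overPos i)` lie on different state circles.
(For virtual diagrams a flip may be neither a merge nor a split, Viro (2004), §5.) Khovanov (2000),
§4.2; Bar-Natan (2002), §3.1. [cite: Viro2004, §5] -/
def IsMergeAt (σ : L.State) (i : Fin L.n) : Prop :=
  σ i = false ∧ L.circleOf σ (L.arcIn (L.overPos i)) ≠ L.circleOf σ (L.arcOut (L.overPos i))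

/-- The edge `σ → σ[i ↦ 1]` of the cube is a **split** at chord `i`: `σ i = 0` and, after the flip
(in the state `Function.update σ i true`), the two local strands `arcIn (overPos i)`,
`arcOut (overPos i)` lie on different state circles. Khovanov (2000), §4.2; Bar-Natan (2002), §3.1;
Viro (2004), §5. [cite: Viro2004, §5] -/
def IsSplitAt (σ : L.State) (i : Fin L.n) : Prop :=
  σ i = false ∧ L.circleOf (Function.update σ i true) (L.arcIn (L.overPos i)) ≠
    L.circleOf (Function.update σ i true) (L.arcOut (L.overPos i))

/-- Being a merge is decidable. [folklore] -/
instance (σ : L.State) (i : Fin L.n) : Decidable (L.IsMergeAt σ i) := by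
  unfold IsMergeAt; infer_instance

/-- Being a split is decidable. [folklore] -/
instance (σ : L.State) (i : Fin L.n) : Decidable (L.IsSplitAt σ i) := by
  unfold IsSplitAt; infer_instance

/-! ## Free circles and the chord part: counting state circles -/

/-- A free circle is related to no arc (left slot). [folklore] -/
theorem not_stateAdj_inr_left (σ : L.State) (j : Fin L.free) (b : L.Arc) :
    ¬ L.stateAdj σ (.inr j) b := by
  simp [stateAdj, arcIn, arcOut]

/-- A free circle is related to no arc (right slot). [folklore] -/
theorem not_stateAdj_inr_right (σ : L.State) (a : L.Arc) (j : Fin L.free) :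
    ¬ L.stateAdj σ a (.inr j) := by
  simp [stateAdj, arcIn, arcOut]

/-- A free circle is an isolated vertex of every state graph (left slot). [folklore] -/
theorem not_stateGraph_adj_inr_left (σ : L.State) (j : Fin L.free) (b : L.Arc) :
    ¬ (L.stateGraph σ).Adj (.inr j) b := by
  simp [stateGraph, SimpleGraph.fromRel_adj, not_stateAdj_inr_left, not_stateAdj_inr_right]

/-- A free circle is an isolated vertex of every state graph (right slot). [folklore] -/
theorem not_stateGraph_adj_inr_right (σ : L.State) (a : L.Arc) (j : Fin L.free) :
    ¬ (L.stateGraph σ).Adj a (.inr j) := by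
  simp [stateGraph, SimpleGraph.fromRel_adj, not_stateAdj_inr_left, not_stateAdj_inr_right]

/-- The reconnection relation **read on marked points** (arc `inl q` ↦ its starting point `q`):
the clauses of `stateAdj` with `arcIn p ↦ next⁻¹ p`, `arcOut p ↦ p`. It does not mention `free`.
Viro (2004), §2. [cite: Viro2004, §2] -/
def pointAdj (σ : L.State) (q r : Fin (2 * L.n)) : Prop :=
  q ≠ r ∧ ∃ p : Fin (2 * L.n),
    (L.isSeifert σ (L.chordOf p) = true ∧
      ((q = L.next.symm p ∧ r = L.partner p) ∨ (r = L.next.symm p ∧ q = L.partner p))) ∨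
    (L.isSeifert σ (L.chordOf p) = false ∧
      ((q = L.next.symm p ∧ r = L.next.symm (L.partner p)) ∨ (q = p ∧ r = L.partner p)))

/-- The point form of the reconnection relation is decidable. [folklore] -/
instance (σ : L.State) : DecidableRel (L.pointAdj σ) := fun a b ↦ by
  unfold pointAdj; infer_instance

/-- The **core graph** of the state `σ`: the reconnection graph on the `2n` marked points (i.e. on
the arcs through marked points), forgetting the free circles. Viro (2004), §2.
[cite: Viro2004, §2] -/
def coreGraph (σ : L.State) : SimpleGraph (Fin (2 * L.n)) :=
  SimpleGraph.fromRel (L.pointAdj σ)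

/-- Adjacency in the core graph is decidable. [folklore] -/
instance (σ : L.State) : DecidableRel (L.coreGraph σ).Adj := fun a b ↦ by
  unfold coreGraph; infer_instance

/-- On arcs through marked points the reconnection relation is its point form. [folklore] -/
theorem stateAdj_inl_inl (σ : L.State) (q r : Fin (2 * L.n)) :
    L.stateAdj σ (.inl q) (.inl r) ↔ L.pointAdj σ q r := by
  simp only [stateAdj, pointAdj, arcIn, arcOut, Sum.inl.injEq, ne_eq]

/-- On arcs through marked points the state graph is the core graph. [folklore] -/
theorem stateGraph_adj_inl_inl (σ : L.State) (q r : Fin (2 * L.n)) :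
    (L.stateGraph σ).Adj (.inl q) (.inl r) ↔ (L.coreGraph σ).Adj q r := by
  simp only [stateGraph, coreGraph, SimpleGraph.fromRel_adj, stateAdj_inl_inl, ne_eq, Sum.inl.injEq]

/-- The inclusion of the core graph into the state graph, as a graph homomorphism. [folklore] -/
def inlHom (σ : L.State) : L.coreGraph σ →g L.stateGraph σ where
  toFun := Sum.inl
  map_rel' h := (L.stateGraph_adj_inl_inl σ _ _).2 h

/-- The **circle part** of an arc: the core component of its starting point for an arc through
marked points, the free circle itself for a free circle. [folklore] -/
def circlePart (σ : L.State) : L.Arc → (L.coreGraph σ).ConnectedComponent ⊕ Fin L.free :=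
  Sum.map (L.coreGraph σ).connectedComponentMk id

/-- Adjacent arcs have the same circle part. [folklore] -/
theorem circlePart_eq_of_adj (σ : L.State) {a b : L.Arc} (h : (L.stateGraph σ).Adj a b) :
    L.circlePart σ a = L.circlePart σ b := by
  cases a with
  | inr j => exact absurd h (L.not_stateGraph_adj_inr_left σ j b)
  | inl q =>
    cases b with
    | inr j => exact absurd h (L.not_stateGraph_adj_inr_right σ (.inl q) j)
    | inl r =>
      exact congrArg Sum.inl
        (SimpleGraph.ConnectedComponent.sound ((L.stateGraph_adj_inl_inl σ q r).1 h).reachable)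

/-- Arcs on the same state circle have the same circle part. [folklore] -/
theorem circlePart_eq_of_reachable (σ : L.State) {a b : L.Arc}
    (h : (L.stateGraph σ).Reachable a b) : L.circlePart σ a = L.circlePart σ b := by
  obtain ⟨w⟩ := h
  induction w with
  | nil => rfl
  | cons hadj _ ih => exact (L.circlePart_eq_of_adj σ hadj).trans ih

/-- **State circles = circles through marked points ⊔ free circles**: the state circles of `σ` are
in explicit bijection with the connected components of the core graph together with the free
circles. Khovanov (2000), §4.2 (a crossingless component is a circle of every resolution).
[cite: Khovanov2000, §4.2] -/
def stateCircleEquiv (σ : L.State) :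
    L.StateCircle σ ≃ (L.coreGraph σ).ConnectedComponent ⊕ Fin L.free where
  toFun := SimpleGraph.ConnectedComponent.lift (L.circlePart σ)
    fun _ _ w _ ↦ L.circlePart_eq_of_reachable σ w.reachable
  invFun := Sum.elim (SimpleGraph.ConnectedComponent.map (L.inlHom σ)) fun j ↦ L.circleOf σ (.inr j)
  left_inv c := by
    induction c using SimpleGraph.ConnectedComponent.ind with
    | h a => rcases a with q | j <;> rfl
  right_inv x := by
    rcases x with c | j
    · induction c using SimpleGraph.ConnectedComponent.ind with
      | h q => rfl
    · rfl

/-- Two arcs lie on the same state circle iff they have the same circle part. [folklore] -/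
theorem circleOf_eq_circleOf_iff (σ : L.State) (a b : L.Arc) :
    L.circleOf σ a = L.circleOf σ b ↔ L.circlePart σ a = L.circlePart σ b :=
  (L.stateCircleEquiv σ).injective.eq_iff.symm

/-- **A free circle is a state circle on its own**: the state circle of the free circle `j` contains
no other arc. Khovanov (2000), §4.2. [cite: Khovanov2000, §4.2] -/
theorem circleOf_inr_eq_iff (σ : L.State) (j : Fin L.free) (b : L.Arc) :
    L.circleOf σ (.inr j) = L.circleOf σ b ↔ b = .inr j := by
  rw [circleOf_eq_circleOf_iff]
  rcases b with q | j'
  · simp [circlePart]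
  · simp [circlePart, eq_comm]

/-- **Counting state circles**: the number of state circles is the number of circles through marked
points plus the number of free circles. Khovanov (2000), §4.2; Bar-Natan (2002), §3.1.
[cite: Khovanov2000, §4.2] -/
theorem circleCount_eq_card_add_free (σ : L.State) :
    L.circleCount σ = Fintype.card (L.coreGraph σ).ConnectedComponent + L.free :=
  calc L.circleCount σ = Fintype.card ((L.coreGraph σ).ConnectedComponent ⊕ Fin L.free) :=
      Fintype.card_congr (L.stateCircleEquiv σ)
    _ = _ := by rw [Fintype.card_sum, Fintype.card_fin]

/-- A diagram without chords has as many state circles as free circles (in its unique state).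
[folklore] -/
theorem circleCount_of_n_eq_zero (h : L.n = 0) (σ : L.State) : L.circleCount σ = L.free := by
  haveI : IsEmpty (Fin (2 * L.n)) := ⟨fun q ↦ by have := q.isLt; omega⟩
  have h0 : Fintype.card (L.coreGraph σ).ConnectedComponent = 0 :=
    Fintype.card_eq_zero_iff.2 ⟨fun c ↦ c.ind (fun q ↦ isEmptyElim q)⟩
  rw [circleCount_eq_card_add_free, h0, Nat.zero_add]

/-- **Sanity (every state).** The crossingless diagram with `k` free circles has exactly `k` state
circles: the crossingless unknot diagram `unknots 1` has one (as `GaussDiagram.circleCount_empty`),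
and `unknots 0 = ofGaussDiagram GaussDiagram.empty` has none. Bar-Natan (2002), §3.1 (unknot,
unlinks). [cite: BarNatan2002, §3.1] -/
theorem circleCount_unknots (k : ℕ) (σ : (unknots k).State) : (unknots k).circleCount σ = k :=
  (unknots k).circleCount_of_n_eq_zero rfl σ

/-- A birth on the `k` unknots gives the `k + 1` unknots (so `unknots 1 = (unknots 0).birth`),
definitionally. Rasmussen (2010), §4.1. [cite: Rasmussen2010, §4.1] -/
theorem birth_unknots (k : ℕ) : (unknots k).birth = unknots (k + 1) := rfl

/-- A death on the `k + 1` unknots gives the `k` unknots (definitionally). Rasmussen (2010), §4.1.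
[cite: Rasmussen2010, §4.1] -/
theorem death_unknots (k : ℕ) : (unknots (k + 1)).death = unknots k := rfl

/-- **A birth adds one state circle** (in every state): the new free circle. Rasmussen (2010), §4.1;
Khovanov (2000), §4.2. [cite: Rasmussen2010, §4.1] -/
theorem circleCount_birth (σ : L.State) : L.birth.circleCount σ = L.circleCount σ + 1 := by
  rw [circleCount_eq_card_add_free, circleCount_eq_card_add_free, Nat.add_assoc]
  rfl

/-- **A death removes one state circle** (in every state), provided there is a free circle to kill
(with `free = 0`, `death` is the identity). Rasmussen (2010), §4.1; Khovanov (2000), §4.2.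
[cite: Rasmussen2010, §4.1] -/
theorem circleCount_death (h : L.free ≠ 0) (σ : L.State) :
    L.death.circleCount σ + 1 = L.circleCount σ := by
  have hf : L.death.free + 1 = L.free := Nat.succ_pred_eq_of_ne_zero h
  rw [circleCount_eq_card_add_free, circleCount_eq_card_add_free, Nat.add_assoc, hf]
  rfl

/-- A saddle keeps the arcs (same `n`, same `free`; only `next` changes), definitionally.
Rasmussen (2010), §4.1. [cite: Rasmussen2010, §4.1] -/
theorem arc_saddle (p q : Fin (2 * L.n)) : (L.saddle p q).Arc = L.Arc := rfl

/-! ## Agreement with the knot tower on `ofGaussDiagram` -/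

/-- The inverse rotation on `Fin m` in coordinates: `(finRotate m)⁻¹ p = p + m - 1 (mod m)`, the
formula of `GaussDiagram.arcIn`. [folklore] -/
theorem val_finRotate_symm {m : ℕ} (p : Fin m) :
    (((finRotate m).symm p : Fin m) : ℕ) = (p.val + m - 1) % m := by
  obtain ⟨q, rfl⟩ := (finRotate m).surjective p
  rw [Equiv.symm_apply_apply]
  cases m with
  | zero => exact q.elim0
  | succ m =>
    rw [coe_finRotate]
    split_ifs with h
    · subst h
      rw [Fin.val_last, show 0 + (m + 1) - 1 = m by omega, Nat.mod_eq_of_lt (Nat.lt_succ_self m)]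
    · have := q.isLt
      rw [show q.val + 1 + (m + 1) - 1 = q.val + (m + 1) by omega, Nat.add_mod_right,
        Nat.mod_eq_of_lt this]

/-- A knot diagram with at least one chord has `2n` arcs (`arcCount = max (2n) 1`). [folklore] -/
theorem arcCount_eq_of_ne_zero (G : GaussDiagram) (hG : G.n ≠ 0) : G.arcCount = 2 * G.n := by
  unfold GaussDiagram.arcCount; omega

/-- **The arcs of `ofGaussDiagram G` are the arcs of `G`** when `G.n ≠ 0`: the explicit equivalence
`inl p ↦ p` (there is no free circle; for `G.n = 0` the two sides differ, `0` versus `1` arc, see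
the module docstring). Viro (2004), §2. [cite: Viro2004, §2] -/
def arcEquiv (G : GaussDiagram) (hG : G.n ≠ 0) : (ofGaussDiagram G).Arc ≃ G.Arc where
  toFun := Sum.elim G.arcOut Fin.elim0
  invFun a := Sum.inl ⟨a.val, by
    have := a.isLt; unfold GaussDiagram.arcCount at this; simp only [ofGaussDiagram_n]; omega⟩
  left_inv a := by
    rcases a with p | j
    · rfl
    · exact j.elim0
  right_inv _ := rfl

/-- `arcEquiv` carries the arc leaving `p` to the knot tower's arc leaving `p` (definitionally).
[folklore] -/
@[simp]
theorem arcEquiv_arcOut (G : GaussDiagram) (hG : G.n ≠ 0) (p : Fin (2 * G.n)) :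
    arcEquiv G hG ((ofGaussDiagram G).arcOut p) = G.arcOut p := rfl

/-- `arcEquiv` carries the arc entering `p` (the arc leaving `(finRotate (2n))⁻¹ p`) to the knot
tower's arc entering `p` (arc number `(p + 2n - 1) % 2n`). [folklore] -/
@[simp]
theorem arcEquiv_arcIn (G : GaussDiagram) (hG : G.n ≠ 0) (p : Fin (2 * G.n)) :
    arcEquiv G hG ((ofGaussDiagram G).arcIn p) = G.arcIn p :=
  Fin.ext (val_finRotate_symm p)

/-- **The reconnection relations correspond** under `arcEquiv` (same chords, partners, Seifert rule;
`arcIn`/`arcOut` correspond). Viro (2004), §2. [cite: Viro2004, §2] -/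
theorem stateAdj_ofGaussDiagram_iff (G : GaussDiagram) (hG : G.n ≠ 0) (σ : G.State)
    (a b : (ofGaussDiagram G).Arc) :
    (ofGaussDiagram G).stateAdj σ a b ↔ G.stateAdj σ (arcEquiv G hG a) (arcEquiv G hG b) := by
  simp only [stateAdj, GaussDiagram.stateAdj, ← arcEquiv_arcOut G hG, ← arcEquiv_arcIn G hG,
    (arcEquiv G hG).injective.eq_iff, ne_eq, chordOf_ofGaussDiagram, partner_ofGaussDiagram,
    isSeifert_ofGaussDiagram, ofGaussDiagram_n]

/-- **The state graphs are isomorphic** along `arcEquiv` (for `G.n ≠ 0`). Viro (2004), §2.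
[cite: Viro2004, §2] -/
def stateGraphIso (G : GaussDiagram) (hG : G.n ≠ 0) (σ : G.State) :
    (ofGaussDiagram G).stateGraph σ ≃g G.stateGraph σ where
  toEquiv := arcEquiv G hG
  map_rel_iff' {a b} := by
    simp only [stateGraph, GaussDiagram.stateGraph, SimpleGraph.fromRel_adj,
      stateAdj_ofGaussDiagram_iff G hG, (arcEquiv G hG).injective.ne_iff]

/-- **State circles correspond**: two arcs of `ofGaussDiagram G` lie on the same state circle iff
their images under `arcEquiv` do. Viro (2004), §2. [cite: Viro2004, §2] -/
theorem circleOf_ofGaussDiagram_eq_iff (G : GaussDiagram) (hG : G.n ≠ 0) (σ : G.State)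
    (a b : (ofGaussDiagram G).Arc) :
    (ofGaussDiagram G).circleOf σ a = (ofGaussDiagram G).circleOf σ b ↔
      G.circleOf σ (arcEquiv G hG a) = G.circleOf σ (arcEquiv G hG b) := by
  simp only [circleOf, GaussDiagram.circleOf, SimpleGraph.ConnectedComponent.eq]
  exact (SimpleGraph.Iso.reachable_iff (φ := stateGraphIso G hG σ)).symm

/-- **The numbers of state circles agree** on the image of a knot diagram with at least one chord
(for `G.n = 0` they are `0` and `1`, see `circleCount_ofGaussDiagram_of_n_eq_zero`). Khovanov
(2000), §4.2; Bar-Natan (2002), §3.1. [cite: BarNatan2002, §3.1] -/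
theorem circleCount_ofGaussDiagram (G : GaussDiagram) (hG : G.n ≠ 0) (σ : G.State) :
    (ofGaussDiagram G).circleCount σ = G.circleCount σ :=
  Fintype.card_congr (stateGraphIso G hG σ).connectedComponentEquiv

/-- The `n = 0` caveat: the image of a chord-free knot diagram has NO state circle (no arc), whereas
the knot tower gives it one (`GaussDiagram.circleCount_empty`). [folklore] -/
theorem circleCount_ofGaussDiagram_of_n_eq_zero (G : GaussDiagram) (hG : G.n = 0) (σ : G.State) :
    (ofGaussDiagram G).circleCount σ = 0 :=
  (ofGaussDiagram G).circleCount_of_n_eq_zero hG σ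

/-- **Merges correspond** on the image of a knot diagram. Bar-Natan (2002), §3.1.
[cite: BarNatan2002, §3.1] -/
theorem isMergeAt_ofGaussDiagram_iff (G : GaussDiagram) (hG : G.n ≠ 0) (σ : G.State) (i : Fin G.n) :
    (ofGaussDiagram G).IsMergeAt σ i ↔ G.IsMergeAt σ i := by
  simp only [IsMergeAt, GaussDiagram.IsMergeAt, ne_eq, circleOf_ofGaussDiagram_eq_iff G hG,
    arcEquiv_arcIn, arcEquiv_arcOut, ofGaussDiagram_overPos]

/-- **Splits correspond** on the image of a knot diagram. Bar-Natan (2002), §3.1.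
[cite: BarNatan2002, §3.1] -/
theorem isSplitAt_ofGaussDiagram_iff (G : GaussDiagram) (hG : G.n ≠ 0) (σ : G.State) (i : Fin G.n) :
    (ofGaussDiagram G).IsSplitAt σ i ↔ G.IsSplitAt σ i := by
  simp only [IsSplitAt, GaussDiagram.IsSplitAt, ne_eq, circleOf_ofGaussDiagram_eq_iff G hG,
    arcEquiv_arcIn, arcEquiv_arcOut, ofGaussDiagram_overPos]
  exact Iff.rfl

/-! ## Sanity data and checks -/

/-- The **positive Hopf link** read from its standard two-crossing diagram: component `A` carries
the marked points `0, 1` (`next`: `0 ↦ 1 ↦ 0`), component `B` the points `2, 3`; chord `0` goes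
over at `0` (on `A`) and under at `2` (on `B`), chord `1` over at `3` (on `B`) and under at `1` (on
`A`); both crossings positive (the standard first example of a Khovanov cube: `2, 1, 1, 2`
circles). [folklore] -/
def hopfLink : LinkGaussDiagram where
  n := 2
  free := 0
  overPos := ![0, 3]
  underPos := ![2, 1]
  sign := fun _ ↦ 1
  bijective := by decide
  next := Equiv.swap 0 1 * Equiv.swap 2 3

/-- The oriented (all-`0`, Seifert) resolution of the positive Hopf link has two circles (guard on
the handling of `next` in `arcIn`). [folklore] -/
theorem circleCount_hopfLink_false : hopfLink.circleCount (fun _ ↦ false) = 2 := by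
  set_option maxRecDepth 8000 in decide

/-- A mixed resolution of the Hopf link has one circle. [folklore] -/
theorem circleCount_hopfLink_mixed : hopfLink.circleCount ![true, false] = 1 := by
  set_option maxRecDepth 8000 in decide

/-- The all-`1` resolution of the Hopf link has two circles. [folklore] -/
theorem circleCount_hopfLink_true : hopfLink.circleCount (fun _ ↦ true) = 2 := by
  set_option maxRecDepth 8000 in decide

/-- In the Hopf link the flip `0 → 1` at chord `0` from the oriented resolution is a merge.
[folklore] -/
theorem isMergeAt_hopfLink : hopfLink.IsMergeAt (fun _ ↦ false) ⟨0, by decide⟩ := by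
  set_option maxRecDepth 8000 in decide

/-- The knot tower's kink, transported: two circles in the `0`-state of the positive kink (from
`GaussDiagram.circleCount_kink_false` by the correspondence). Bar-Natan (2002), §3.1.
[cite: BarNatan2002, §3.1] -/
theorem circleCount_ofGaussDiagram_kink_false :
    (ofGaussDiagram (GaussDiagram.kink 1)).circleCount (fun _ ↦ false) = 2 := by
  rw [circleCount_ofGaussDiagram _ (by decide)]
  exact GaussDiagram.circleCount_kink_false

/-- The knot tower's kink, transported: the flip at its chord from the `0`-state is a merge (from
`GaussDiagram.isMergeAt_kink`). Bar-Natan (2002), §3.1. [cite: BarNatan2002, §3.1] -/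
theorem isMergeAt_ofGaussDiagram_kink :
    (ofGaussDiagram (GaussDiagram.kink 1)).IsMergeAt (fun _ ↦ false) ⟨0, Nat.one_pos⟩ := by
  rw [isMergeAt_ofGaussDiagram_iff _ (by decide)]
  exact GaussDiagram.isMergeAt_kink

/-! ## A merge is not a split (port of section `NotSplit` of `KhResolutions`)

Arc-ends `(p, b) : Fin (2 * n) × Bool` (`b = false`: the end of `arcIn p` at `p`; `b = true`: the
end of `arcOut p` at `p`) carry the fixed-point-free involutions `endFlip` (other end of the same
arc, now through `next`) and `endGlue σ` (the end glued to it); a set of arcs closed under the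
gluings at the chords `≠ i` meets an even number of the four ends at chord `i`. -/

section NotSplit

/-- The arc carrying an arc-end: `(p, false) ↦ arcIn p`, `(p, true) ↦ arcOut p`. [folklore] -/
def endArc : Fin (2 * L.n) × Bool → L.Arc
  | (p, false) => L.arcIn p
  | (p, true) => L.arcOut p

/-- The **other end of the same arc**: the end of `arcIn p` at `p` is matched with the end of the
same arc `arcOut (next⁻¹ p)` at `next⁻¹ p`, and the end of `arcOut p` at `p` with the end of
`arcIn (next p)` at `next p` (knot tower: `p ∓ 1`). [folklore] -/
def endFlip : Fin (2 * L.n) × Bool → Fin (2 * L.n) × Bool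
  | (p, false) => (L.next.symm p, true)
  | (p, true) => (L.next p, false)

/-- `endFlip` is an involution. [folklore] -/
@[simp]
theorem endFlip_endFlip (e : Fin (2 * L.n) × Bool) : L.endFlip (L.endFlip e) = e := by
  obtain ⟨p, _ | _⟩ := e <;> simp [endFlip]

/-- `endFlip` has no fixed point. [folklore] -/
theorem endFlip_ne (e : Fin (2 * L.n) × Bool) : L.endFlip e ≠ e := by
  obtain ⟨p, _ | _⟩ := e <;> simp [endFlip]

/-- The two ends matched by `endFlip` lie on the same arc. [folklore] -/
@[simp]
theorem endArc_endFlip (e : Fin (2 * L.n) × Bool) : L.endArc (L.endFlip e) = L.endArc e := by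
  obtain ⟨p, _ | _⟩ := e <;> simp [endFlip, endArc]

/-- The **gluing** of arc-ends in the state `σ`: the end `(p, b)` is glued to the end at the partner
point, of the opposite kind (`in ↔ out`) at a Seifert chord and of the same kind at a non-Seifert
chord (cf. `stateAdj`). Viro (2004), §2, §5. [cite: Viro2004, §5] -/
def endGlue (σ : L.State) : Fin (2 * L.n) × Bool → Fin (2 * L.n) × Bool
  | (p, b) => (L.partner p, if L.isSeifert σ (L.chordOf p) then !b else b)

/-- `endGlue σ` is an involution. [folklore] -/
@[simp]
theorem endGlue_endGlue (σ : L.State) (e : Fin (2 * L.n) × Bool) :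
    L.endGlue σ (L.endGlue σ e) = e := by
  obtain ⟨p, b⟩ := e
  cases hs : L.isSeifert σ (L.chordOf p) <;> cases b <;> simp [endGlue, hs]

/-- `endGlue σ` has no fixed point. [folklore] -/
theorem endGlue_ne (σ : L.State) (e : Fin (2 * L.n) × Bool) : L.endGlue σ e ≠ e := by
  obtain ⟨p, b⟩ := e
  simp only [endGlue, ne_eq, Prod.mk.injEq, not_and]
  exact fun h ↦ absurd h (L.partner_ne p)

/-- Glued ends lie on the same state circle: their arcs are equal or adjacent in the state graph.
[folklore] -/
theorem reachable_endArc_endGlue (σ : L.State) (e : Fin (2 * L.n) × Bool) :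
    (L.stateGraph σ).Reachable (L.endArc e) (L.endArc (L.endGlue σ e)) := by
  by_cases heq : L.endArc e = L.endArc (L.endGlue σ e)
  · rw [← heq]
  refine SimpleGraph.Adj.reachable ?_
  rw [stateGraph, SimpleGraph.fromRel_adj]
  refine ⟨heq, Or.inl ⟨heq, ?_⟩⟩
  obtain ⟨p, b⟩ := e
  cases hs : L.isSeifert σ (L.chordOf p) <;> cases b
  · exact ⟨p, Or.inr ⟨hs, Or.inl ⟨rfl, by simp [endArc, endGlue, hs]⟩⟩⟩
  · exact ⟨p, Or.inr ⟨hs, Or.inr ⟨rfl, by simp [endArc, endGlue, hs]⟩⟩⟩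
  · exact ⟨p, Or.inl ⟨hs, Or.inl ⟨rfl, by simp [endArc, endGlue, hs]⟩⟩⟩
  · refine ⟨L.partner p, Or.inl ⟨by simpa using hs, Or.inr ⟨?_, ?_⟩⟩⟩ <;>
      simp [endArc, endGlue, hs]

/-- The gluing of an end away from chord `i` does not see a change of smoothing at `i`.
[folklore] -/
theorem endGlue_update_of_ne (σ : L.State) {i : Fin L.n} (b : Bool) {e : Fin (2 * L.n) × Bool}
    (ho : e.1 ≠ L.overPos i) (hu : e.1 ≠ L.underPos i) :
    L.endGlue (Function.update σ i b) e = L.endGlue σ e := by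
  obtain ⟨p, c⟩ := e
  simp only [endGlue, L.isSeifert_update_of_ne σ b (L.chordOf_ne ho hu)]

/-- **Parity count.** Let `K` be a set of arcs closed under the gluings of the state `σ` at all
chords other than `i`. Then `K` carries an even number of the four arc-ends at chord `i` (every arc
has two ends, and the ends away from chord `i` that lie on `K` are matched in pairs by the gluing).
Uses the knot tower's `GaussDiagram.even_card_of_involutive`. [folklore] -/
theorem even_card_ends_at (σ : L.State) (i : Fin L.n) (K : Set L.Arc) [DecidablePred (· ∈ K)]
    (hK : ∀ e : Fin (2 * L.n) × Bool, e.1 ≠ L.overPos i → e.1 ≠ L.underPos i →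
      L.endArc e ∈ K → L.endArc (L.endGlue σ e) ∈ K) :
    Even (Finset.univ.filter fun e : Fin (2 * L.n) × Bool ↦
      L.endArc e ∈ K ∧ (e.1 = L.overPos i ∨ e.1 = L.underPos i)).card := by
  classical
  set T : Finset (Fin (2 * L.n) × Bool) := Finset.univ.filter fun e ↦ L.endArc e ∈ K with hT
  set S : Finset (Fin (2 * L.n) × Bool) :=
    Finset.univ.filter fun e ↦ e.1 = L.overPos i ∨ e.1 = L.underPos i with hS
  have hTS : (Finset.univ.filter fun e : Fin (2 * L.n) × Bool ↦
      L.endArc e ∈ K ∧ (e.1 = L.overPos i ∨ e.1 = L.underPos i)) = T ∩ S := by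
    ext e; simp [hT, hS]
  rw [hTS]
  -- every arc has two ends: `T` is `endFlip`-invariant
  have h₁ : Even T.card := by
    refine GaussDiagram.even_card_of_involutive T L.endFlip (fun e he ↦ ?_)
      (fun e _ ↦ L.endFlip_endFlip e) (fun e _ ↦ L.endFlip_ne e)
    simpa [hT] using he
  -- the ends of `T` away from chord `i` are matched by the gluing
  have h₂ : Even (T \ S).card := by
    refine GaussDiagram.even_card_of_involutive (T \ S) (L.endGlue σ) (fun e he ↦ ?_)
      (fun e _ ↦ L.endGlue_endGlue σ e) (fun e _ ↦ L.endGlue_ne σ e)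
    simp only [Finset.mem_sdiff, hT, hS, Finset.mem_filter, Finset.mem_univ, true_and,
      not_or] at he ⊢
    obtain ⟨heK, ho, hu⟩ := he
    refine ⟨hK e ho hu heK, ?_, ?_⟩
    · intro h
      apply hu
      have := congrArg L.partner h
      obtain ⟨p, b⟩ := e
      simpa [endGlue] using this
    · intro h
      apply ho
      have := congrArg L.partner h
      obtain ⟨p, b⟩ := e
      simpa [endGlue] using this
  have h₃ := Finset.card_sdiff_add_card_inter T S
  rw [← h₃] at h₁
  exact (Nat.even_add.mp h₁).mp h₂

variable {L} in
/-- **A merge is not a split** (for every, possibly virtual, link Gauss diagram): if the two local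
strands at a `0`-smoothed chord `i` lie on different state circles, then after the flip `0 → 1` at
`i` they lie on the same state circle — surgery of a closed 1-manifold along a band joining two
distinct components yields one component. The knot tower's proof verbatim (parity count of the ends
at chord `i` on the set of arcs reachable from `arcIn (overPos i)` both before and after the flip,
`even_card_ends_at`). Viro (2004), §5.2; Bar-Natan (2002), §3.1. [cite: Viro2004, §5.2] -/
theorem IsMergeAt.not_isSplitAt {σ : L.State} {i : Fin L.n} (hM : L.IsMergeAt σ i) :
    ¬ L.IsSplitAt σ i := by
  intro hS
  classical
  set σ' : L.State := Function.update σ i true with hσ'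
  set o := L.overPos i with ho
  set u := L.underPos i with hu
  obtain ⟨hσi, hM⟩ := hM
  obtain ⟨-, hS⟩ := hS
  rw [circleOf, circleOf, Ne, SimpleGraph.ConnectedComponent.eq] at hM hS
  -- the arcs reachable from `A = arcIn o` both before and after the flip
  set K : Set L.Arc := {a | (L.stateGraph σ).Reachable (L.arcIn o) a ∧
    (L.stateGraph σ').Reachable (L.arcIn o) a} with hK
  have hKcl : ∀ e : Fin (2 * L.n) × Bool, e.1 ≠ o → e.1 ≠ u →
      L.endArc e ∈ K → L.endArc (L.endGlue σ e) ∈ K := by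
    intro e h1 h2 ⟨hr, hr'⟩
    refine ⟨hr.trans (L.reachable_endArc_endGlue σ e), hr'.trans ?_⟩
    rw [← L.endGlue_update_of_ne σ true h1 h2]
    exact L.reachable_endArc_endGlue σ' e
  have hev := L.even_card_ends_at σ i K hKcl
  -- the end `(o, in)` of `A` lies on `K`; hence so does another end at chord `i`
  have hA : L.endArc (o, false) ∈ K :=
    ⟨SimpleGraph.Reachable.refl _, SimpleGraph.Reachable.refl _⟩
  have key : L.endArc (o, true) ∈ K ∨ ∃ b, L.endArc (u, b) ∈ K := by
    by_contra hcon
    push Not at hcon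
    obtain ⟨hB, hC⟩ := hcon
    have : (Finset.univ.filter fun e : Fin (2 * L.n) × Bool ↦
        L.endArc e ∈ K ∧ (e.1 = L.overPos i ∨ e.1 = L.underPos i)) = {(o, false)} := by
      ext ⟨p, b⟩
      simp only [Finset.mem_filter, Finset.mem_univ, true_and, Finset.mem_singleton,
        Prod.mk.injEq]
      constructor
      · rintro ⟨hk, rfl | rfl⟩
        · cases b
          · exact ⟨rfl, rfl⟩
          · exact absurd hk hB
        · exact absurd hk (hC b)
      · rintro ⟨rfl, rfl⟩
        exact ⟨hA, Or.inl rfl⟩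
    rw [this, Finset.card_singleton] at hev
    exact Nat.not_even_one hev
  rcases key with hB | ⟨b, hb⟩
  · -- `B = arcOut o` reachable from `A` before the flip: not a merge
    exact hM hB.1
  · -- an end at `u` lies on `K`; it is glued to `(o, out)` either before or after the flip
    have hglue : L.endGlue σ (u, b) = (o, true) ∨ L.endGlue σ' (u, b) = (o, true) := by
      have h1 : L.chordOf u = i := L.chordOf_underPos i
      have h2 : L.partner u = o := L.partner_underPos i
      simp only [endGlue, h1, h2, isSeifert, hσ', Function.update_self, hσi, Prod.mk.injEq,
        true_and]
      cases b <;> cases (L.sign i == 1) <;> simp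
    rcases hglue with h | h
    · have := L.reachable_endArc_endGlue σ (u, b)
      rw [h] at this
      exact hM (hb.1.trans this)
    · have := L.reachable_endArc_endGlue σ' (u, b)
      rw [h] at this
      exact hS (hb.2.trans this)

end NotSplit

end LinkGaussDiagram

end Literature.Topology.FourManifolds

end
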